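import Summits.BirchSwinnertonDyer.BirchSwinnertonDyer.Theorems.PrintCFramBottomClassIndexLawFiveLeFlipRungOfJML
import HarnessLib

/-!
# Crux `PrintCFram.BottomClassIndexLawFiveLe` (stmt-BirchSwinnertonDyer-20372), line `eisenstein-resource-bdp-line` (registry v28 → v29):
# «T8 — THE LOWER-UNIPOTENT RUNG», piece T8-5 — (RungAll⁶) ⟸ (JMLall⁶): the rung at EVERY odd `q ∣ m` (no flip condition) in
# Cohen-number currency, from the joint modular lemma of the lower-unipotent road
# (cell `bsd-print-cfram`, width seat `bsd-line-cfram-p1-w8` g9; THEOREMS ONLY, `--supports` 20372; BSD is not proved by any of this)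

HONEST FRAMING. Nothing here is a statement about BSD; no registered stub is closed. Registry v29 (LEAD g14 09:04:50Z) replaces
`stub_flipRung` (flips at the odd `q ∣ m` with `q* ≢ 1 (mod p)`) by `stub_flipRungs := (FlipRungAll⁶) ∧ (FlipRungTwo⁶)`, where (FlipRungAll⁶)
drops the flip condition: seat w2 g15 found that Raum 2023 Prop. 2.3 — the ramified square-class coupling through the LOWER UNIPOTENT
`γ_t = [1 0; q²C 1]` — has no level-raising exception, and seat w3 g19's blueprint (crux notes `…-w3g19-notes.md` §2, T8) types it in the kernel
with a RATIONAL weight (the Kloosterman trace trick (U5) + pigeonhole (U6), `…FlipRungLowerUnipotentWeight`, p710371). This file is T8-5,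
the twin of this seat's B/3 (`rung_six_of_jml`, p709047) for that road:

* (RungAll⁶) := (Rung⁶) with the line `¬ ((p : ℤ) ∣ (q : ℤ) * jacobiSym (-1) q - 1) →` deleted (= w2 g15's text; their
  `flipRungAll_six_of_rungAll : (RungAll⁶) → (FlipRungAll⁶)` is the layer-A twin).
* (JMLall⁶), the joint modular lemma of the lower-unipotent road (no modular object in the statement): for a class datum, a `±1` pattern
  `τ`, an odd prime `q ∣ m`, a unit `v (mod q)` and any `a` equal to `H(k,·)` on the AWAY-from-`q` cut and `0` off it, there are `N`
  (`p ∤ N`, `2 ∣ N`), `D` (`q² ∣ D`, a period of the away cut) and `Θ : PowerSeries ℕ` (`Θ(0) = 1`, supported on `Dℕ`) such that: if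
  `coeff n (a ⋆ Θ) ∈ p·ℤ̄[1/N]` at every `n ≡ q·v (mod q²)` (the single-class twist `V_{qv}` is `≡ 0 (mod p)` at `∞`), then
  `‖coeff n (a ⋆ Θ)‖_p ≤ p⁻¹` at EVERY `n` with `q ∥ n` (both Legendre classes; the modular assembler reads the cusps `γ_t` through
  `norm_ratCast_le_inv_of_kloosterman_memberships`).
* **`rungAll_six_of_jmlAll : (JMLall⁶) → (RungAll⁶)`**: choose `v` in the Legendre class `σ = τ(q)·J(−1|q)·J(m_q|q)` of the full cut
  (`v = 1`, or a non-residue, `exists_unit_jacobiSym_eq`); input side = B/1 `fullCut_iff_awayCut_and_at` + B/2 deconvolution (⇐) over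
  `{‖·‖_p ≤ p⁻¹} ⊓ {dyadic}` with the `q²`-periodic class `n ≡ qv (mod q²)` + Carlitz + the input reading; output side = deconvolution (⇒) with
  the `q²`-periodic class `q ∥ n`, then B/1 at the flipped pattern (the Legendre class at `q` is now irrelevant).

So `(FlipRungAll⁶) ⟸ (JMLall⁶)` by name (`flipRungAll_six_of_rungAll ∘ rungAll_six_of_jmlAll`), and T8-1/2/3/4/7 compose to (JMLall⁶).
No definitions, no named facts, no `sorry`. beyond-print theorem: NO (assembly). References: [Raum2023RamanujanTypeII] Prop. 2.3, Lemma 2.4;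
[Cohen1975] Thm. 3.1; [Katz1973] Cor. 1.6.2 (currency only); crux notes lead-g14 §2, w3g19 §2.
-/

set_option autoImplicit false
-- summit-side namespace `Summit.BirchSwinnertonDyer.BirchSwinnertonDyer.…` (single-conjunct summit, D-0017 layout)
set_option linter.dupNamespace false

noncomputable section

open scoped Classical NumberTheorySymbols
open PowerSeries DirichletCharacter
open Literature.NumberTheory.ModularForms.CohenEisenstein

namespace Summit.BirchSwinnertonDyer.BirchSwinnertonDyer.Theorems.PrintCFram.FlipRung

open Summit.BirchSwinnertonDyer.BirchSwinnertonDyer.Theorems.PrintCFram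

/-! ## §1 Small pieces -/

/-- The predicate `q ∥ n` is invariant under `n ↦ n + D·t` for `q² ∣ D`. [folklore] -/
theorem dvdExact_add_iff (q D n t : ℕ) (hD : q ^ 2 ∣ D) :
    (q ∣ n + D * t ∧ ¬ q ^ 2 ∣ n + D * t) ↔ (q ∣ n ∧ ¬ q ^ 2 ∣ n) := by
  obtain ⟨E, rfl⟩ := hD
  have h1 : q ∣ n + q ^ 2 * E * t ↔ q ∣ n := Nat.dvd_add_left ⟨q * E * t, by ring⟩
  have h2 : q ^ 2 ∣ n + q ^ 2 * E * t ↔ q ^ 2 ∣ n := Nat.dvd_add_left ⟨E * t, by ring⟩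
  rw [h1, h2]

/-- The predicate `q ∥ n` is `D`-periodic for `q² ∣ D`. [folklore] -/
theorem dvdExact_periodic (q D : ℕ) (hD : q ^ 2 ∣ D) :
    Function.Periodic (fun n : ℕ => q ∣ n ∧ ¬ q ^ 2 ∣ n) D := by
  intro n
  have h := dvdExact_add_iff q D n 1 hD
  rw [mul_one] at h
  exact propext h

/-- The single residue class `n ≡ r (mod q²)` is `D`-periodic for `q² ∣ D`. [folklore] -/
theorem modSq_periodic (q D r : ℕ) (hD : q ^ 2 ∣ D) :
    Function.Periodic (fun n : ℕ => n % q ^ 2 = r % q ^ 2) D := by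
  intro n
  obtain ⟨E, rfl⟩ := hD
  simp only [Nat.add_mul_mod_self_left]

/-- An index of the single class `n ≡ q·v (mod q²)` with `q ∤ v` has `q ∥ n` and Legendre class `J(n/q | q) = J(v | q)`. [folklore] -/
theorem classAt_of_modSq {q v n : ℕ} (hq : q.Prime) (hv : ¬ q ∣ v) (h : n % q ^ 2 = q * v % q ^ 2) :
    q ∣ n ∧ ¬ q ^ 2 ∣ n ∧ jacobiSym ((n / q : ℕ) : ℤ) q = jacobiSym ((v : ℕ) : ℤ) q := by
  have hq0 : 0 < q := hq.pos
  set w : ℕ := q * (n / q ^ 2) + v % q with hw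
  have hqv : q * v % q ^ 2 = q * (v % q) := by rw [pow_two, Nat.mul_mod_mul_left]
  have hn : n = q * w := by
    have e := (Nat.div_add_mod n (q ^ 2)).symm
    rw [h, hqv] at e
    rw [e, hw]; ring
  have hwq : w % q = v % q := by
    rw [hw, add_comm, Nat.add_mul_mod_self_left, Nat.mod_mod]
  have hqw : ¬ q ∣ w := by
    intro hd
    apply hv
    apply Nat.dvd_of_mod_eq_zero
    rw [← hwq]
    exact Nat.mod_eq_zero_of_dvd hd
  refine ⟨⟨w, hn⟩, ?_, ?_⟩
  · rintro ⟨c, hc⟩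
    apply hqw
    refine ⟨c, Nat.eq_of_mul_eq_mul_left hq0 ?_⟩
    rw [← hn, hc]; ring
  · have hdiv : n / q = w := by rw [hn, Nat.mul_div_cancel_left _ hq0]
    rw [hdiv, jacobiSym.mod_left ((w : ℕ) : ℤ), jacobiSym.mod_left ((v : ℕ) : ℤ), ← Int.natCast_mod, ← Int.natCast_mod, hwq]

/-- **A unit of prescribed Legendre class**: for an odd prime `q` and `s = ±1` there is `v` with `q ∤ v` and `J(v | q) = s`
(`v = 1`, or a quadratic non-residue). [folklore] -/
theorem exists_unit_jacobiSym_eq {q : ℕ} (hq : q.Prime) (hq2 : q ≠ 2) {s : ℤ} (hs : s = 1 ∨ s = -1) :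
    ∃ v : ℕ, ¬ q ∣ v ∧ jacobiSym ((v : ℕ) : ℤ) q = s := by
  haveI : Fact q.Prime := ⟨hq⟩
  rcases hs with rfl | rfl
  · exact ⟨1, fun h => hq.one_lt.ne' (Nat.dvd_one.mp h), by simp [jacobiSym.one_left]⟩
  · have hchar : ringChar (ZMod q) ≠ 2 := by rw [ZMod.ringChar_zmod_n]; exact hq2
    obtain ⟨x, hx⟩ := FiniteField.exists_nonsquare hchar
    have hx0 : x ≠ 0 := by rintro rfl; exact hx IsSquare.zero
    refine ⟨x.val, fun h => hx0 ?_, ?_⟩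
    · have h0 : x.val = 0 := Nat.eq_zero_of_dvd_of_lt h (ZMod.val_lt x)
      exact (ZMod.val_eq_zero x).mp h0
    · rw [← jacobiSym.legendreSym.to_jacobiSym, legendreSym.eq_neg_one_iff]
      rwa [Int.cast_natCast, ZMod.natCast_zmod_val]

/-! ## §2 (RungAll⁶) ⟸ (JMLall⁶) -/

/-- **THE RUNG AT EVERY ODD `q ∣ m`, IN COHEN-NUMBER CURRENCY, FROM THE JOINT MODULAR LEMMA OF THE LOWER-UNIPOTENT ROAD.** See the module
docstring for (JMLall⁶) (the hypothesis `hJML`) and (RungAll⁶) (the conclusion = (Rung⁶) minus the flip condition). PROOF. `q ∥ m`;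
`σ := τ(q)·J(−1|q)·J(m_q|q)`; a unit `v` with `J(v|q) = σ`; `a := H(k,·)` on AWAY, `0` off it; `N, D, Θ` from (JMLall⁶). INPUT: an index
`n ≡ qv (mod q²)` has `q ∥ n` and class `σ`, so every term of `coeff n (a ⋆ Θ)` (indices `≡ n (mod D)`, `q² ∣ D`) is AWAY ∧ class `σ` = FULL_τ
or has `a = 0`; FULL ⟹ `‖H‖_p ≤ p⁻¹` (hypothesis) and `2^j·H ∈ ℤ` (Carlitz); deconvolution (⇐) and the input reading give the memberships. OUTPUT:
(JMLall⁶) gives `‖coeff n (a ⋆ Θ)‖_p ≤ p⁻¹` at every `q ∥ n`; deconvolution (⇒) gives `‖a(n)‖_p ≤ p⁻¹` there; a FULL index of the flipped pattern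
is AWAY (same away pattern) with `q ∥`, where `a = H(k,·)`. [cite: Raum2023RamanujanTypeII, Prop. 2.3] [cite: Cohen1975, Thm. 3.1] -/
theorem rungAll_six_of_jmlAll
    (hJML : ∀ (p : ℕ) [Fact p.Prime] (m : ℕ) [NeZero m] (χ : DirichletCharacter ℚ_[p] m) (k : ℕ),
      (p = 7 ∨ p = 11 ∨ p = 19 ∨ p = 43 ∨ p = 67 ∨ p = 163) →
      m.Coprime p → χ.IsPrimitive → χ.IsQuadratic → (k = (p + 1) / 4 ∨ k = (3 * p - 1) / 4) →
      2 ≤ k → k ≤ p - 2 → χ (-1) * (-1) ^ k = -1 →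
      ∀ (τ : ℕ → ℤ) (q : ℕ), q.Prime → q ∣ m → q ≠ 2 →
      (∀ q' : ℕ, q'.Prime → q' ∣ m → q' ≠ 2 → (τ q' = 1 ∨ τ q' = -1)) →
      ∀ (v : ℕ), ¬ q ∣ v →
      ∀ (a : ℕ → ℚ),
        (∀ i : ℕ, (m / q ∣ i ∧ i / (m / q) % 4 = 3 * q % 4 ∧
            (∀ q' : ℕ, q'.Prime → q' ∣ m / q → q' ≠ 2 →
              jacobiSym (-((i / (m / q) : ℕ) : ℤ)) q' = τ q' * jacobiSym (q : ℤ) q') ∧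
            (2 ∣ m → i / (m / q) % 8 = 7 * q % 8) ∧ (q ≠ 3 → ¬ 3 ∣ i / (m / q))) → a i = cohenH k i) →
        (∀ i : ℕ, ¬ (m / q ∣ i ∧ i / (m / q) % 4 = 3 * q % 4 ∧
            (∀ q' : ℕ, q'.Prime → q' ∣ m / q → q' ≠ 2 →
              jacobiSym (-((i / (m / q) : ℕ) : ℤ)) q' = τ q' * jacobiSym (q : ℤ) q') ∧
            (2 ∣ m → i / (m / q) % 8 = 7 * q % 8) ∧ (q ≠ 3 → ¬ 3 ∣ i / (m / q))) → a i = 0) →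
      ∃ (N D : ℕ) (Θ : PowerSeries ℕ),
        ¬ p ∣ N ∧ 2 ∣ N ∧ q ^ 2 ∣ D ∧
        Function.Periodic (fun i : ℕ => (m / q ∣ i ∧ i / (m / q) % 4 = 3 * q % 4 ∧
            (∀ q' : ℕ, q'.Prime → q' ∣ m / q → q' ≠ 2 →
              jacobiSym (-((i / (m / q) : ℕ) : ℤ)) q' = τ q' * jacobiSym (q : ℤ) q') ∧
            (2 ∣ m → i / (m / q) % 8 = 7 * q % 8) ∧ (q ≠ 3 → ¬ 3 ∣ i / (m / q)))) D ∧
        PowerSeries.coeff 0 Θ = 1 ∧ (∀ j : ℕ, PowerSeries.coeff j Θ ≠ 0 → D ∣ j) ∧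
        ((∀ n : ℕ, n % q ^ 2 = q * v % q ^ 2 →
            ∃ y : ℂ, (∃ j : ℕ, IsIntegral ℤ ((N : ℂ) ^ j * y)) ∧
              ((PowerSeries.coeff n (PowerSeries.mk a * PowerSeries.map (Nat.castRingHom ℚ) Θ) : ℚ) : ℂ) = (p : ℂ) * y) →
          ∀ n : ℕ, q ∣ n → ¬ q ^ 2 ∣ n →
            ‖((PowerSeries.coeff n (PowerSeries.mk a * PowerSeries.map (Nat.castRingHom ℚ) Θ) : ℚ) : ℚ_[p])‖ ≤ (p : ℝ)⁻¹)) :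
    ∀ (p : ℕ) [Fact p.Prime] (m : ℕ) [NeZero m] (χ : DirichletCharacter ℚ_[p] m) (k : ℕ),
      (p = 7 ∨ p = 11 ∨ p = 19 ∨ p = 43 ∨ p = 67 ∨ p = 163) →
      m.Coprime p → χ.IsPrimitive → χ.IsQuadratic → (k = (p + 1) / 4 ∨ k = (3 * p - 1) / 4) →
      2 ≤ k → k ≤ p - 2 → χ (-1) * (-1) ^ k = -1 →
      ∀ (τ : ℕ → ℤ) (q : ℕ), q.Prime → q ∣ m → q ≠ 2 →
      (∀ q' : ℕ, q'.Prime → q' ∣ m → q' ≠ 2 → (τ q' = 1 ∨ τ q' = -1)) →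
      (∀ a : ℕ, m ∣ a → a / m % 4 = 3 →
        (∀ q' : ℕ, q'.Prime → q' ∣ m → q' ≠ 2 → jacobiSym (-((a / m : ℕ) : ℤ)) q' = τ q') →
        (2 ∣ m → a / m % 8 = 7) → ¬ 3 ∣ a / m → ‖((cohenH k a : ℚ) : ℚ_[p])‖ ≤ (p : ℝ)⁻¹) →
      ∀ a : ℕ, m ∣ a → a / m % 4 = 3 →
        (∀ q' : ℕ, q'.Prime → q' ∣ m → q' ≠ 2 → jacobiSym (-((a / m : ℕ) : ℤ)) q' = (if q' = q then -τ q' else τ q')) →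
        (2 ∣ m → a / m % 8 = 7) → ¬ 3 ∣ a / m → ‖((cohenH k a : ℚ) : ℚ_[p])‖ ≤ (p : ℝ)⁻¹ := by
  intro p _ m _ χ k hp6 hmp hχ hχq hk hk2 hkp hpar τ q hq hqm hq2 hτ hcut a' hma' ha4' hJ' h8' h3'
  have hq0 : 0 < q := hq.pos
  have hm0 : 0 < m := Nat.pos_of_ne_zero (NeZero.ne m)
  have hk1 : 1 ≤ k := by omega
  have hm1 : m ≠ 1 := by
    rintro rfl
    exact hq.one_lt.ne' (Nat.dvd_one.mp hqm)
  -- `q ∥ m`, `m_q := m / q`, `q ∤ m_q`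
  have hqm2 : ¬ q ^ 2 ∣ m := not_sq_dvd_conductor_of_odd_prime hχ hχq hq hq2 hqm
  obtain ⟨mq, hm⟩ := hqm
  have hmq : m / q = mq := by rw [hm, Nat.mul_div_cancel_left _ hq0]
  have hqmq : ¬ q ∣ mq := by
    rintro ⟨c, rfl⟩
    exact hqm2 ⟨c, by rw [hm]; ring⟩
  -- the flipped pattern and the sign at `q`
  set τ' : ℕ → ℤ := fun x => if x = q then -τ x else τ x with hτ'def
  have hτ' : ∀ q' : ℕ, q'.Prime → q' ∣ m → q' ≠ 2 → (τ' q' = 1 ∨ τ' q' = -1) := by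
    intro q' hq' hq'm hq'2
    rcases hτ q' hq' hq'm hq'2 with h | h
    · by_cases hqq : q' = q
      · subst hqq; simp [hτ'def, h]
      · simp [hτ'def, hqq, h]
    · by_cases hqq : q' = q
      · subst hqq; simp [hτ'def, h]
      · simp [hτ'def, hqq, h]
  have hτq : τ q = 1 ∨ τ q = -1 := hτ q hq ⟨mq, hm⟩ hq2
  set σ : ℤ := τ q * jacobiSym (-1) q * jacobiSym ((m / q : ℕ) : ℤ) q with hσdef
  have hσ : σ = 1 ∨ σ = -1 := by rw [hσdef, hmq]; exact sign_at_q_eq_one_or hq hqmq hτq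
  -- a unit `v` of class `σ`
  obtain ⟨v, hv, hvσ⟩ := exists_unit_jacobiSym_eq hq hq2 hσ
  -- the coefficient function of the away-cut
  set a : ℕ → ℚ := fun i =>
    if (m / q ∣ i ∧ i / (m / q) % 4 = 3 * q % 4 ∧
            (∀ q' : ℕ, q'.Prime → q' ∣ m / q → q' ≠ 2 →
              jacobiSym (-((i / (m / q) : ℕ) : ℤ)) q' = τ q' * jacobiSym (q : ℤ) q') ∧
            (2 ∣ m → i / (m / q) % 8 = 7 * q % 8) ∧ (q ≠ 3 → ¬ 3 ∣ i / (m / q)))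
    then cohenH k i else 0 with hadef
  obtain ⟨N, D, Θ, hpN, h2N, hqD, hperA, hΘ0, hΘ, himp⟩ :=
    hJML p m χ k hp6 hmp hχ hχq hk hk2 hkp hpar τ q hq ⟨mq, hm⟩ hq2 hτ v hv a
      (fun i hi => by rw [hadef]; exact if_pos hi) (fun i hi => by rw [hadef]; exact if_neg hi)
  -- the two subgroups and the two periodic classes
  obtain ⟨Sp, hSp⟩ := exists_addSubgroup_padicNorm_le p
  obtain ⟨S2, hS2⟩ := exists_addSubgroup_dyadic
  have hperIn := modSq_periodic q D (q * v) hqD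
  have hperOut := dvdExact_periodic q D hqD
  -- INPUT: the coefficients of `a` on the class `n ≡ qv (mod q²)` lie in `Sp ⊓ S2`
  have hin : ∀ n : ℕ, n % q ^ 2 = q * v % q ^ 2 → PowerSeries.coeff n (PowerSeries.mk a) ∈ Sp ⊓ S2 := by
    intro n hn
    obtain ⟨hqn, hq2n, hcls⟩ := classAt_of_modSq hq hv hn
    rw [hvσ] at hcls
    rw [PowerSeries.coeff_mk, AddSubgroup.mem_inf, hSp, hS2]
    by_cases hA : (m / q ∣ n ∧ n / (m / q) % 4 = 3 * q % 4 ∧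
            (∀ q' : ℕ, q'.Prime → q' ∣ m / q → q' ≠ 2 →
              jacobiSym (-((n / (m / q) : ℕ) : ℤ)) q' = τ q' * jacobiSym (q : ℤ) q') ∧
            (2 ∣ m → n / (m / q) % 8 = 7 * q % 8) ∧ (q ≠ 3 → ¬ 3 ∣ n / (m / q)))
    · have ha : a n = cohenH k n := by rw [hadef]; exact if_pos hA
      obtain ⟨hmn, hn4, hJn, hn8, hn3⟩ :=
        (fullCut_iff_awayCut_and_at hq hq2 ⟨mq, hm⟩ hqm2 hτ n).mpr ⟨hA, hqn, hq2n, hcls⟩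
      rw [ha]
      exact ⟨hcut n hmn hn4 hJn hn8 hn3,
        exists_two_pow_mul_cohenH_eq_intCast_of_cut_sign hm1 hχ hχq hk1 hpar hτ hmn hn4 hJn⟩
    · have ha : a n = 0 := by rw [hadef]; exact if_neg hA
      rw [ha]
      exact ⟨by simp, ⟨0, 0, by simp⟩⟩
  have hin' := forall_coeff_mul_mem_of_periodic (Sp ⊓ S2) (PowerSeries.mk a) Θ hΘ0 hΘ hperIn hin
  have hinQ : ∀ n : ℕ, n % q ^ 2 = q * v % q ^ 2 →
      ∃ y : ℂ, (∃ j : ℕ, IsIntegral ℤ ((N : ℂ) ^ j * y)) ∧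
        ((PowerSeries.coeff n (PowerSeries.mk a * PowerSeries.map (Nat.castRingHom ℚ) Θ) : ℚ) : ℂ) = (p : ℂ) * y := by
    intro n hn
    have hmem := hin' n hn
    rw [AddSubgroup.mem_inf, hSp, hS2] at hmem
    exact exists_eq_prime_mul_isIntegral_of_padicNorm_le h2N hmem.1 hmem.2
  -- OUTPUT at every `q ∥ n`
  have hout := himp hinQ
  have hout' : ∀ n : ℕ, (q ∣ n ∧ ¬ q ^ 2 ∣ n) →
      PowerSeries.coeff n (PowerSeries.mk a * PowerSeries.map (Nat.castRingHom ℚ) Θ) ∈ Sp := by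
    rintro n ⟨hqn, hq2n⟩
    rw [hSp]
    exact hout n hqn hq2n
  have houtA := forall_coeff_mem_of_mul_mem_of_periodic Sp (PowerSeries.mk a) Θ hΘ0 hΘ hperOut hout'
  -- the target index `a'` is AWAY (flipped pattern agrees away from `q`) with `q ∥ a'`
  obtain ⟨hA', hqa', hq2a', -⟩ := (fullCut_iff_awayCut_and_at hq hq2 ⟨mq, hm⟩ hqm2 hτ' a').mp ⟨hma', ha4', hJ', h8', h3'⟩
  have hA : (m / q ∣ a' ∧ a' / (m / q) % 4 = 3 * q % 4 ∧
            (∀ q' : ℕ, q'.Prime → q' ∣ m / q → q' ≠ 2 →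
              jacobiSym (-((a' / (m / q) : ℕ) : ℤ)) q' = τ q' * jacobiSym (q : ℤ) q') ∧
            (2 ∣ m → a' / (m / q) % 8 = 7 * q % 8) ∧ (q ≠ 3 → ¬ 3 ∣ a' / (m / q))) := by
    obtain ⟨h1, h2, h3, h4, h5⟩ := hA'
    refine ⟨h1, h2, fun q' hq' hq'm hq'2 => ?_, h4, h5⟩
    have hqq : q' ≠ q := by
      rintro rfl
      rw [hmq] at hq'm
      exact hqmq hq'm
    have := h3 q' hq' hq'm hq'2
    rw [hτ'def] at this
    simpa [hqq] using this
  have hmem := houtA a' ⟨hqa', hq2a'⟩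
  rw [PowerSeries.coeff_mk, hSp] at hmem
  have ha : a a' = cohenH k a' := by rw [hadef]; exact if_pos hA
  rw [ha] at hmem
  exact hmem

end Summit.BirchSwinnertonDyer.BirchSwinnertonDyer.Theorems.PrintCFram.FlipRung

end
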